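import Summits.NavierStokesRegularity.OSWSelfSimilar.SheetRLinearisedCutoffEnergy
import HarnessLib

/-!
# SHEET-ℝ frame, MODEL ASSEMBLY for Z3-SR-SPEC (P1): the solution operator of the SKEW-COUPLED PAIR system
# `(A)u_R − t·u_I = g_R`, `(A)u_I + t·u_R = g_I` (`A = −∂² + d∂ + V` real) — the realified complex resolvent

HONEST FRAMING (cell ns-blowup GROUP B / zone Z3, case Z3-SR-SPEC, PAPER item (P1) «the resolvent `R(σ) = (A_F + σ)⁻¹ : L²_w → dom ⊂ E`
exists as a single-valued bounded operator for COMPLEX `σ`»; 1-D MODEL certificate frame (viscous gCLM/OSW sheet on the line); not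
Euler/NS; «violates: none — MODEL»). Nothing here asserts that a profile exists; the coercivity `hcoer` (the certificate's (C1) at the
shifted potential `V + Re σ`, a POINTWISE datum by `SheetRLinearisedCoercivity`) is the HYPOTHESIS.

For a complex spectral parameter `σ = s + it` the equation `(A + σ)u = g` with REAL coefficients (`A = −∂² + d∂ + V`; put the real
shift `s` into `V`) is, in real and imaginary parts `u = u_R + iu_I`, `g = g_R + ig_I`, the skew-coupled pair system
`A u_R − t u_I = g_R`, `A u_I + t u_R = g_I`.  Its weak form on the product Hilbert space `WithLp 2 (Esp × Esp)` against pairs of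
compactly supported tests is coercive on the diagonal EXACTLY when the scalar form is (the `±t` cross terms cancel), so Lions' theorem
in operator form (`Literature.Analysis.OperatorTheory.exists_solutionOperator_of_coercive`) applies verbatim:

* `Bcpl` — the coupling pairing `(p, (v, v₁)) ↦ ∫ w·prim(der p)·v` as a bilinear map, `|Bcpl p v| ≤ 4‖p‖‖jmap v‖`;
* `exists_pairSolutionOperator` — **there is a bounded linear `S : WithLp 2 (W L × W L) →L[ℝ] WithLp 2 (Esp L hL × Esp L hL)` whose value
  at `(g_R, g_I)` solves the pair system weakly against every compactly supported test, with `‖S G‖ ≤ (4/κ)‖G‖`**;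
* `pairSolution_unique` — two energy-space pair solutions with the same data coincide (`SheetRLinearisedCutoffEnergy.pair_eq_zero_of_weak`),
  so every energy-space weak solution of the pair system IS `S G`.

The complex packaging (`Lp ℂ 2 μw`, `ℂ`-linearity, the resolvent identity) is the next file.  Pure functional analysis; one bundled map
(`Bcpl`), two auxiliary bundled maps (`Eform2`, `Pdata2`), no named fact.  WHAT THIS IS NOT: not NS; no number of record moves.
-/

noncomputable section

namespace Summit.NavierStokesRegularity.OSWSelfSimilar
namespace SheetRResolventPair

open _root_.MeasureTheory _root_.Set _root_.Filter _root_.Real SheetRWeakProfilePV SheetRWeakToStrong SheetREnergyClass SheetRWeightedMeasure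
  SheetRLinearisedTests SheetREnergySpace SheetRTestSpace SheetRLinearisedFormBounds SheetRSolutionOperator SheetRLinearisedCutoffEnergy
  Literature.Analysis.OperatorTheory
open scoped Topology ENNReal

variable {L D₀ D₁ V₀ : ℝ} {d V : ℝ → ℝ}

/-! ### §1 The coupling pairing `∫ w·prim(der p)·v` -/

/-- The weighted product of an energy-space profile with a test is integrable, and `|∫ w·prim(der p)·v| ≤ 4‖p‖·‖jmap (v, v₁)‖`. [folklore] -/
theorem integrable_profile_mul_test (hL : 0 < L) (p : Esp L hL) (vp : testSpace) :
    Integrable (fun y => (L ^ 2 + y ^ 2) * (prim (der p) y * vp.1.1 y)) ∧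
      |∫ y, (L ^ 2 + y ^ 2) * (prim (der p) y * vp.1.1 y)| ≤ 4 * ‖p‖ * ‖jmap hL vp‖ := by
  obtain ⟨hum, -, h0, -, e0, -⟩ := profile_facts hL p
  obtain ⟨hc, -, -, -⟩ := basic_of_isCompactTest vp.2
  have hwv := (weighted_of_isCompactTest (L := L) vp.2).1
  obtain ⟨hi, hb⟩ := integral_weight_abs_mul_le (L := L) hum hc.aestronglyMeasurable h0 hwv
  have hint : Integrable (fun y => (L ^ 2 + y ^ 2) * (prim (der p) y * vp.1.1 y)) := by
    refine hi.mono' ((by fun_prop : AEStronglyMeasurable (fun y : ℝ => L ^ 2 + y ^ 2) volume).mul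
      (hum.mul hc.aestronglyMeasurable)) (Eventually.of_forall fun y => ?_)
    rw [Real.norm_eq_abs, abs_mul, abs_of_nonneg (by positivity : (0:ℝ) ≤ L ^ 2 + y ^ 2)]
  refine ⟨hint, ?_⟩
  have h1 : |∫ y, (L ^ 2 + y ^ 2) * (prim (der p) y * vp.1.1 y)| ≤ ∫ y, (L ^ 2 + y ^ 2) * |prim (der p) y * vp.1.1 y| := by
    rw [← Real.norm_eq_abs]
    refine (norm_integral_le_integral_norm _).trans (le_of_eq (integral_congr_ae (Eventually.of_forall fun y => ?_)))
    show ‖(L ^ 2 + y ^ 2) * (prim (der p) y * vp.1.1 y)‖ = (L ^ 2 + y ^ 2) * |prim (der p) y * vp.1.1 y|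
    rw [Real.norm_eq_abs, abs_mul, abs_of_nonneg (by positivity : (0:ℝ) ≤ L ^ 2 + y ^ 2)]
  have hv : Real.sqrt (∫ y, (L ^ 2 + y ^ 2) * vp.1.1 y ^ 2) ≤ 2 * ‖jmap hL vp‖ := by
    have hsq := sq_norm_jmap hL vp
    have hnn : 0 ≤ ∫ y, (L ^ 2 + y ^ 2) * vp.1.2 y ^ 2 := integral_nonneg fun y => by positivity
    have : ∫ y, (L ^ 2 + y ^ 2) * vp.1.1 y ^ 2 ≤ (2 * ‖jmap hL vp‖) ^ 2 := by nlinarith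
    calc Real.sqrt (∫ y, (L ^ 2 + y ^ 2) * vp.1.1 y ^ 2) ≤ Real.sqrt ((2 * ‖jmap hL vp‖) ^ 2) := Real.sqrt_le_sqrt this
      _ = 2 * ‖jmap hL vp‖ := Real.sqrt_sq (by positivity)
  have hf : ‖(p : WithLp 2 (W L × W L)).fst‖ ≤ ‖p‖ := WithLp.norm_fst_le (x := (p : WithLp 2 (W L × W L)))
  rw [e0] at hb
  calc |∫ y, (L ^ 2 + y ^ 2) * (prim (der p) y * vp.1.1 y)|
      ≤ 2 * ‖(p : WithLp 2 (W L × W L)).fst‖ * Real.sqrt (∫ y, (L ^ 2 + y ^ 2) * vp.1.1 y ^ 2) := h1.trans hb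
    _ ≤ 2 * ‖p‖ * (2 * ‖jmap hL vp‖) := by
        have h2 : 0 ≤ Real.sqrt (∫ y, (L ^ 2 + y ^ 2) * vp.1.1 y ^ 2) := Real.sqrt_nonneg _
        nlinarith [mul_le_mul_of_nonneg_right hf h2, mul_le_mul_of_nonneg_left hv (norm_nonneg p), norm_nonneg p,
          norm_nonneg (jmap hL vp)]
    _ = 4 * ‖p‖ * ‖jmap hL vp‖ := by ring

/-- **The coupling pairing** `(p, (v, v₁)) ↦ ∫ (L²+ξ²)·prim(der p)·v` as a bilinear map `Esp L hL →ₗ testSpace →ₗ ℝ`. [folklore] -/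
def Bcpl (hL : 0 < L) : Esp L hL →ₗ[ℝ] testSpace →ₗ[ℝ] ℝ :=
  LinearMap.mk₂ ℝ (fun (p : Esp L hL) (vp : testSpace) => ∫ y, (L ^ 2 + y ^ 2) * (prim (der p) y * vp.1.1 y))
    (by
      intro p q vp
      rw [← integral_add (integrable_profile_mul_test hL p vp).1 (integrable_profile_mul_test hL q vp).1]
      refine integral_congr_ae (Eventually.of_forall fun y => ?_)
      simp only [congrFun (der_add hL p q).2 y]; ring)
    (by
      intro c p vp
      rw [smul_eq_mul, ← integral_const_mul]
      refine integral_congr_ae (Eventually.of_forall fun y => ?_)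
      simp only [congrFun (der_smul hL c p).2 y]; ring)
    (by
      intro p vp vq
      change ∫ y, (L ^ 2 + y ^ 2) * (prim (der p) y * (vp.1.1 y + vq.1.1 y)) = _
      rw [← integral_add (integrable_profile_mul_test hL p vp).1 (integrable_profile_mul_test hL p vq).1]
      refine integral_congr_ae (Eventually.of_forall fun y => ?_)
      ring)
    (by
      intro c p vp
      change ∫ y, (L ^ 2 + y ^ 2) * (prim (der p) y * (c * vp.1.1 y)) = _
      rw [smul_eq_mul, ← integral_const_mul]
      refine integral_congr_ae (Eventually.of_forall fun y => ?_)
      ring)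

/-- Unfolding `Bcpl`. [folklore] -/
theorem Bcpl_apply (hL : 0 < L) (p : Esp L hL) (vp : testSpace) :
    Bcpl hL p vp = ∫ y, (L ^ 2 + y ^ 2) * (prim (der p) y * vp.1.1 y) := by
  simp only [Bcpl, LinearMap.mk₂_apply]

/-- On embedded tests the coupling pairing is symmetric: `Bcpl (jmap vq) vp = Bcpl (jmap vp) vq` (both are `∫ w v_p v_q`). [folklore] -/
theorem Bcpl_jmap_symm (hL : 0 < L) (vp vq : testSpace) : Bcpl hL (jmap hL vq) vp = Bcpl hL (jmap hL vp) vq := by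
  rw [Bcpl_apply, Bcpl_apply, (jmap_snd_ae hL vq).2, (jmap_snd_ae hL vp).2]
  exact integral_congr_ae (Eventually.of_forall fun y => by ring)

/-! ### §2 The pair weak form and the pair data pairing on the product spaces -/

section Assembly

variable (hL : 0 < L)

/-- **The pair weak form** on `WithLp 2 (Esp × Esp)` against `testSpace × testSpace`:
`((p_R, p_I), (φ, ψ)) ↦ Eform p_R φ − t·Bcpl p_I φ + Eform p_I ψ + t·Bcpl p_R ψ`. [folklore] -/
def Eform2 (hdm : AEStronglyMeasurable d volume) (hVm : AEStronglyMeasurable V volume)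
    (hD₁ : 0 ≤ D₁) (hd : ∀ ξ, |d ξ| ≤ D₀ + D₁ * |ξ|) (hV : ∀ ξ, |V ξ| ≤ V₀) (t : ℝ) :
    WithLp 2 (Esp L hL × Esp L hL) →ₗ[ℝ] (testSpace × testSpace) →ₗ[ℝ] ℝ :=
  LinearMap.mk₂ ℝ
    (fun (P : WithLp 2 (Esp L hL × Esp L hL)) (Φ : testSpace × testSpace) =>
      Eform hL hdm hVm hD₁ hd hV P.fst Φ.1 - t * Bcpl hL P.snd Φ.1 + Eform hL hdm hVm hD₁ hd hV P.snd Φ.2 + t * Bcpl hL P.fst Φ.2)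
    (by intro P Q Φ; simp only [WithLp.add_fst, WithLp.add_snd, map_add, LinearMap.add_apply]; ring)
    (by intro c P Φ; simp only [WithLp.smul_fst, WithLp.smul_snd, map_smul, LinearMap.smul_apply, smul_eq_mul]; ring)
    (by intro P Φ Ψ; simp only [Prod.fst_add, Prod.snd_add, map_add]; ring)
    (by intro c P Φ; simp only [Prod.smul_fst, Prod.smul_snd, map_smul, smul_eq_mul]; ring)

/-- Unfolding `Eform2`. [folklore] -/
theorem Eform2_apply (hdm : AEStronglyMeasurable d volume) (hVm : AEStronglyMeasurable V volume)
    (hD₁ : 0 ≤ D₁) (hd : ∀ ξ, |d ξ| ≤ D₀ + D₁ * |ξ|) (hV : ∀ ξ, |V ξ| ≤ V₀) (t : ℝ)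
    (P : WithLp 2 (Esp L hL × Esp L hL)) (Φ : testSpace × testSpace) :
    Eform2 hL hdm hVm hD₁ hd hV t P Φ =
      Eform hL hdm hVm hD₁ hd hV P.fst Φ.1 - t * Bcpl hL P.snd Φ.1 + Eform hL hdm hVm hD₁ hd hV P.snd Φ.2 + t * Bcpl hL P.fst Φ.2 := by
  simp only [Eform2, LinearMap.mk₂_apply]

/-- **The pair data pairing** `((g_R, g_I), (φ, ψ)) ↦ ∫ w g_R φ + ∫ w g_I ψ`. [folklore] -/
def Pdata2 : WithLp 2 (W L × W L) →ₗ[ℝ] (testSpace × testSpace) →ₗ[ℝ] ℝ :=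
  LinearMap.mk₂ ℝ (fun (G : WithLp 2 (W L × W L)) (Φ : testSpace × testSpace) => Pdata hL G.fst Φ.1 + Pdata hL G.snd Φ.2)
    (by intro G G' Φ; simp only [WithLp.add_fst, WithLp.add_snd, map_add, LinearMap.add_apply]; ring)
    (by intro c G Φ; simp only [WithLp.smul_fst, WithLp.smul_snd, map_smul, LinearMap.smul_apply, smul_eq_mul]; ring)
    (by intro G Φ Ψ; simp only [Prod.fst_add, Prod.snd_add, map_add]; ring)
    (by intro c G Φ; simp only [Prod.smul_fst, Prod.smul_snd, map_smul, smul_eq_mul]; ring)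

/-- Unfolding `Pdata2`. [folklore] -/
theorem Pdata2_apply (G : WithLp 2 (W L × W L)) (Φ : testSpace × testSpace) :
    Pdata2 hL G Φ = Pdata hL G.fst Φ.1 + Pdata hL G.snd Φ.2 := by
  simp only [Pdata2, LinearMap.mk₂_apply]

/-- The embedding of test pairs: `(φ, ψ) ↦ (jmap φ, jmap ψ) ∈ WithLp 2 (Esp × Esp)`. [folklore] -/
def jmap2 : (testSpace × testSpace) →ₗ[ℝ] WithLp 2 (Esp L hL × Esp L hL) :=
  (WithLp.linearEquiv 2 ℝ (Esp L hL × Esp L hL)).symm.toLinearMap ∘ₗ ((jmap hL).prodMap (jmap hL))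

/-- Components of `jmap2`. [folklore] -/
theorem jmap2_fst_snd (Φ : testSpace × testSpace) :
    (jmap2 hL Φ).fst = jmap hL Φ.1 ∧ (jmap2 hL Φ).snd = jmap hL Φ.2 := ⟨rfl, rfl⟩

/-- `‖jmap2 (φ, ψ)‖² = ‖jmap φ‖² + ‖jmap ψ‖²`, so each component norm is at most `‖jmap2 (φ, ψ)‖`. [folklore] -/
theorem norm_jmap_le_norm_jmap2 (Φ : testSpace × testSpace) :
    ‖jmap2 hL Φ‖ ^ 2 = ‖jmap hL Φ.1‖ ^ 2 + ‖jmap hL Φ.2‖ ^ 2 ∧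
      ‖jmap hL Φ.1‖ ≤ ‖jmap2 hL Φ‖ ∧ ‖jmap hL Φ.2‖ ≤ ‖jmap2 hL Φ‖ := by
  obtain ⟨h1, h2⟩ := jmap2_fst_snd hL Φ
  refine ⟨by rw [WithLp.prod_norm_sq_eq_of_L2, h1, h2], ?_, ?_⟩
  · have := WithLp.norm_fst_le (x := jmap2 hL Φ); rwa [h1] at this
  · have := WithLp.norm_snd_le (x := jmap2 hL Φ); rwa [h2] at this

/-! ### §3 The pair solution operator -/

/-- **THE PAIR SOLUTION OPERATOR (realified complex resolvent).**  Under `κ`-coercivity of the scalar form on compactly supported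
tests (`κ > 0`) and for every coupling constant `t`, there is a bounded LINEAR `S : WithLp 2 (W L × W L) →L[ℝ] WithLp 2 (Esp × Esp)`
such that for `(p_R, p_I) = S (g_R, g_I)` and every compactly supported test `(v, v₁)`:
`linForm(u_R; v) − t∫w u_I v = ∫w g_R v` and `linForm(u_I; v) + t∫w u_R v = ∫w g_I v` (`u_• = prim (der p_•)`), with
`‖S G‖ ≤ (4/κ)‖G‖`. [folklore] -/
theorem exists_pairSolutionOperator (hdm : AEStronglyMeasurable d volume) (hVm : AEStronglyMeasurable V volume)
    (hD₁ : 0 ≤ D₁) (hd : ∀ ξ, |d ξ| ≤ D₀ + D₁ * |ξ|) (hV : ∀ ξ, |V ξ| ≤ V₀) (t : ℝ) {κ : ℝ} (hκ : 0 < κ)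
    (hcoer : ∀ v v₁ : ℝ → ℝ, IsCompactTest v v₁ →
      κ * ((∫ ξ, (L ^ 2 + ξ ^ 2) * v₁ ξ ^ 2) + 1 / 4 * ∫ ξ, (L ^ 2 + ξ ^ 2) * v ξ ^ 2) ≤ linForm L d V v v₁ v v₁) :
    ∃ S : WithLp 2 (W L × W L) →L[ℝ] WithLp 2 (Esp L hL × Esp L hL),
      (∀ (G : WithLp 2 (W L × W L)) (v v₁ : ℝ → ℝ), IsCompactTest v v₁ →
        linForm L d V (prim (der (S G).fst)) (der (S G).fst) v v₁ - t * ∫ y, (L ^ 2 + y ^ 2) * (prim (der (S G).snd) y * v y) =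
            ∫ y, (L ^ 2 + y ^ 2) * ((G.fst : ℝ → ℝ) y * v y) ∧
          linForm L d V (prim (der (S G).snd)) (der (S G).snd) v v₁ + t * ∫ y, (L ^ 2 + y ^ 2) * (prim (der (S G).fst) y * v y) =
            ∫ y, (L ^ 2 + y ^ 2) * ((G.snd : ℝ → ℝ) y * v y)) ∧
      ∀ G : WithLp 2 (W L × W L), ‖S G‖ ≤ 4 / κ * ‖G‖ := by
  haveI : CompleteSpace (Esp L hL) := completeSpace_Esp hL
  -- fixed-test bounds for the pair form
  have hE : ∀ Φ : testSpace × testSpace, ∃ K : ℝ, ∀ P : WithLp 2 (Esp L hL × Esp L hL),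
      |Eform2 hL hdm hVm hD₁ hd hV t P Φ| ≤ K * ‖P‖ := by
    intro Φ
    obtain ⟨K₁, hK₁⟩ : ∃ K : ℝ, ∀ p : Esp L hL, |Eform hL hdm hVm hD₁ hd hV p Φ.1| ≤ K * ‖p‖ :=
      ⟨_, fun p => by rw [Eform_apply]; exact (abs_linForm_profile_le hL hdm hVm hD₁ hd hV Φ.1 p).2⟩
    obtain ⟨K₂, hK₂⟩ : ∃ K : ℝ, ∀ p : Esp L hL, |Eform hL hdm hVm hD₁ hd hV p Φ.2| ≤ K * ‖p‖ :=
      ⟨_, fun p => by rw [Eform_apply]; exact (abs_linForm_profile_le hL hdm hVm hD₁ hd hV Φ.2 p).2⟩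
    refine ⟨max K₁ 0 + |t| * (4 * ‖jmap hL Φ.1‖) + max K₂ 0 + |t| * (4 * ‖jmap hL Φ.2‖), fun P => ?_⟩
    rw [Eform2_apply]
    have hf : ‖P.fst‖ ≤ ‖P‖ := WithLp.norm_fst_le (x := P)
    have hs : ‖P.snd‖ ≤ ‖P‖ := WithLp.norm_snd_le (x := P)
    have h1 := hK₁ P.fst
    have h2 := hK₂ P.snd
    have h3 : |t * Bcpl hL P.snd Φ.1| ≤ |t| * (4 * ‖jmap hL Φ.1‖) * ‖P‖ := by
      rw [abs_mul, Bcpl_apply]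
      have := (integrable_profile_mul_test hL P.snd Φ.1).2
      calc |t| * |∫ y, (L ^ 2 + y ^ 2) * (prim (der P.snd) y * Φ.1.1.1 y)| ≤ |t| * (4 * ‖P.snd‖ * ‖jmap hL Φ.1‖) :=
            mul_le_mul_of_nonneg_left this (abs_nonneg t)
        _ ≤ |t| * (4 * ‖P‖ * ‖jmap hL Φ.1‖) := by gcongr
        _ = |t| * (4 * ‖jmap hL Φ.1‖) * ‖P‖ := by ring
    have h4 : |t * Bcpl hL P.fst Φ.2| ≤ |t| * (4 * ‖jmap hL Φ.2‖) * ‖P‖ := by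
      rw [abs_mul, Bcpl_apply]
      have := (integrable_profile_mul_test hL P.fst Φ.2).2
      calc |t| * |∫ y, (L ^ 2 + y ^ 2) * (prim (der P.fst) y * Φ.2.1.1 y)| ≤ |t| * (4 * ‖P.fst‖ * ‖jmap hL Φ.2‖) :=
            mul_le_mul_of_nonneg_left this (abs_nonneg t)
        _ ≤ |t| * (4 * ‖P‖ * ‖jmap hL Φ.2‖) := by gcongr
        _ = |t| * (4 * ‖jmap hL Φ.2‖) * ‖P‖ := by ring
    have hb1 : |Eform hL hdm hVm hD₁ hd hV P.fst Φ.1| ≤ max K₁ 0 * ‖P‖ :=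
      h1.trans ((mul_le_mul_of_nonneg_right (le_max_left _ _) (norm_nonneg _)).trans
        (mul_le_mul_of_nonneg_left hf (le_max_right _ _)))
    have hb2 : |Eform hL hdm hVm hD₁ hd hV P.snd Φ.2| ≤ max K₂ 0 * ‖P‖ :=
      h2.trans ((mul_le_mul_of_nonneg_right (le_max_left _ _) (norm_nonneg _)).trans
        (mul_le_mul_of_nonneg_left hs (le_max_right _ _)))
    calc |Eform hL hdm hVm hD₁ hd hV P.fst Φ.1 - t * Bcpl hL P.snd Φ.1 + Eform hL hdm hVm hD₁ hd hV P.snd Φ.2 + t * Bcpl hL P.fst Φ.2|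
        ≤ |Eform hL hdm hVm hD₁ hd hV P.fst Φ.1| + |t * Bcpl hL P.snd Φ.1| + |Eform hL hdm hVm hD₁ hd hV P.snd Φ.2|
            + |t * Bcpl hL P.fst Φ.2| := by
          refine (abs_add_le _ _).trans (add_le_add ((abs_add_le _ _).trans (add_le_add (abs_sub _ _) le_rfl)) le_rfl)
      _ ≤ max K₁ 0 * ‖P‖ + |t| * (4 * ‖jmap hL Φ.1‖) * ‖P‖ + max K₂ 0 * ‖P‖ + |t| * (4 * ‖jmap hL Φ.2‖) * ‖P‖ := by
          gcongr
      _ = (max K₁ 0 + |t| * (4 * ‖jmap hL Φ.1‖) + max K₂ 0 + |t| * (4 * ‖jmap hL Φ.2‖)) * ‖P‖ := by ring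
  -- coercivity on the diagonal: the cross terms cancel
  have hcoer2 : ∀ Φ : testSpace × testSpace, κ * ‖jmap2 hL Φ‖ ^ 2 ≤ Eform2 hL hdm hVm hD₁ hd hV t (jmap2 hL Φ) Φ := by
    intro Φ
    obtain ⟨h1, h2⟩ := jmap2_fst_snd hL Φ
    rw [Eform2_apply, h1, h2, Bcpl_jmap_symm hL Φ.2 Φ.1, Eform_jmap, Eform_jmap, (norm_jmap_le_norm_jmap2 hL Φ).1,
      sq_norm_jmap, sq_norm_jmap]
    have hc1 := hcoer Φ.1.1.1 Φ.1.1.2 Φ.1.2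
    have hc2 := hcoer Φ.2.1.1 Φ.2.1.2 Φ.2.2
    nlinarith
  -- the data bound
  have hP : ∀ (G : WithLp 2 (W L × W L)) (Φ : testSpace × testSpace), |Pdata2 hL G Φ| ≤ 4 * ‖G‖ * ‖jmap2 hL Φ‖ := by
    intro G Φ
    rw [Pdata2_apply]
    obtain ⟨-, hj1, hj2⟩ := norm_jmap_le_norm_jmap2 hL Φ
    have hf : ‖G.fst‖ ≤ ‖G‖ := WithLp.norm_fst_le (x := G)
    have hs : ‖G.snd‖ ≤ ‖G‖ := WithLp.norm_snd_le (x := G)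
    have h1 := abs_Pdata_le hL G.fst Φ.1
    have h2 := abs_Pdata_le hL G.snd Φ.2
    calc |Pdata hL G.fst Φ.1 + Pdata hL G.snd Φ.2| ≤ |Pdata hL G.fst Φ.1| + |Pdata hL G.snd Φ.2| := abs_add_le _ _
      _ ≤ 2 * ‖G.fst‖ * ‖jmap hL Φ.1‖ + 2 * ‖G.snd‖ * ‖jmap hL Φ.2‖ := add_le_add h1 h2
      _ ≤ 2 * ‖G‖ * ‖jmap2 hL Φ‖ + 2 * ‖G‖ * ‖jmap2 hL Φ‖ := by
          gcongr
      _ = 4 * ‖G‖ * ‖jmap2 hL Φ‖ := by ring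
  obtain ⟨S, hS, hSn⟩ := exists_solutionOperator_of_coercive (F := WithLp 2 (Esp L hL × Esp L hL)) (jmap2 hL)
    (fun Φ => ‖jmap2 hL Φ‖) (fun _ => norm_nonneg _) (C := 1) zero_le_one (fun Φ => by rw [one_mul])
    (Eform2 hL hdm hVm hD₁ hd hV t) hE hκ hcoer2 (Pdata2 hL) (CP := 4) (by norm_num) hP
  refine ⟨S, fun G v v₁ hv => ?_, fun G => ?_⟩
  · have h1 := hS G (⟨(v, v₁), hv⟩, 0)
    have h2 := hS G (0, ⟨(v, v₁), hv⟩)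
    rw [Eform2_apply, Pdata2_apply] at h1 h2
    simp only [map_zero, mul_zero, add_zero, sub_zero, zero_add] at h1 h2
    rw [Eform_apply, Bcpl_apply, Pdata_apply] at h1 h2
    exact ⟨h1, h2⟩
  · calc ‖S G‖ ≤ 4 * (1 / κ) * ‖G‖ := hSn G
      _ = 4 / κ * ‖G‖ := by ring

/-! ### §4 Uniqueness: every energy-space weak solution of the pair system is `S G` -/

include hL in
/-- The difference of two energy-class profiles is in the energy class (primitive form, parity, measurability, weights). [folklore] -/
theorem energyClass_sub {u u₁ u' u₁' : ℝ → ℝ}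
    (hu : ∀ x, u x = u 0 + ∫ s in (0 : ℝ)..x, u₁ s) (hodd : ∀ y, u (-y) = -u y) (hu₁m : AEStronglyMeasurable u₁ volume)
    (h0 : Integrable fun y => (L ^ 2 + y ^ 2) * u y ^ 2) (h1 : Integrable fun y => (L ^ 2 + y ^ 2) * u₁ y ^ 2)
    (hu' : ∀ x, u' x = u' 0 + ∫ s in (0 : ℝ)..x, u₁' s) (hodd' : ∀ y, u' (-y) = -u' y) (hu₁m' : AEStronglyMeasurable u₁' volume)
    (h0' : Integrable fun y => (L ^ 2 + y ^ 2) * u' y ^ 2) (h1' : Integrable fun y => (L ^ 2 + y ^ 2) * u₁' y ^ 2) :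
    (∀ x, u x - u' x = (u 0 - u' 0) + ∫ s in (0 : ℝ)..x, (u₁ s - u₁' s)) ∧ (∀ y, u (-y) - u' (-y) = -(u y - u' y)) ∧
      AEStronglyMeasurable (fun s => u₁ s - u₁' s) volume ∧
      Integrable (fun y => (L ^ 2 + y ^ 2) * (u y - u' y) ^ 2) ∧ Integrable (fun y => (L ^ 2 + y ^ 2) * (u₁ y - u₁' y) ^ 2) := by
  have hdiff : ∀ x, u x - u' x = (u 0 - u' 0) + ∫ s in (0 : ℝ)..x, (u₁ s - u₁' s) := by
    intro x
    have hii := intervalIntegrable_of_memLp_two (memLp_two_of_weighted_sq hL hu₁m h1)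
    have hii' := intervalIntegrable_of_memLp_two (memLp_two_of_weighted_sq hL hu₁m' h1')
    rw [intervalIntegral.integral_sub (hii 0 x) (hii' 0 x), hu x, hu' x]
    ring
  have hw2 : ∀ (f g : ℝ → ℝ), Integrable (fun y => (L ^ 2 + y ^ 2) * f y ^ 2) → Integrable (fun y => (L ^ 2 + y ^ 2) * g y ^ 2) →
      AEStronglyMeasurable f volume → AEStronglyMeasurable g volume →
      Integrable (fun y => (L ^ 2 + y ^ 2) * (f y - g y) ^ 2) := by
    intro f g hf hg hfm hgm
    refine ((hf.add hg).const_mul 2).mono' ((by fun_prop : AEStronglyMeasurable (fun y : ℝ => L ^ 2 + y ^ 2) volume).mul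
      ((hfm.sub hgm).pow 2)) (Eventually.of_forall fun y => ?_)
    rw [Real.norm_eq_abs, abs_of_nonneg (by positivity)]
    simp only [Pi.add_apply]
    have hw : 0 ≤ L ^ 2 + y ^ 2 := by positivity
    nlinarith [mul_nonneg hw (sq_nonneg (f y + g y))]
  obtain ⟨huc, -, -, -, -⟩ := basic_of_primitive hL hu hu₁m h0 h1
  obtain ⟨huc', -, -, -, -⟩ := basic_of_primitive hL hu' hu₁m' h0' h1'
  exact ⟨hdiff, fun y => by rw [hodd, hodd']; ring, hu₁m.sub hu₁m',
    hw2 u u' h0 h0' huc.aestronglyMeasurable huc'.aestronglyMeasurable, hw2 u₁ u₁' h1 h1' hu₁m hu₁m'⟩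

/-- **Uniqueness for the pair system**: two energy-space pairs solving the pair system weakly with the same right-hand sides coincide
(so every energy-space weak solution with data `G` IS `S G`). [folklore] -/
theorem pairSolution_unique (hdm : AEStronglyMeasurable d volume) (hVm : AEStronglyMeasurable V volume)
    (hD₀ : 0 ≤ D₀) (hD₁ : 0 ≤ D₁) (hd : ∀ ξ, |d ξ| ≤ D₀ + D₁ * |ξ|) (hV : ∀ ξ, |V ξ| ≤ V₀) (t : ℝ) {κ : ℝ} (hκ : 0 < κ)
    (hcoer : ∀ v v₁ : ℝ → ℝ, IsCompactTest v v₁ →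
      κ * ((∫ ξ, (L ^ 2 + ξ ^ 2) * v₁ ξ ^ 2) + 1 / 4 * ∫ ξ, (L ^ 2 + ξ ^ 2) * v ξ ^ 2) ≤ linForm L d V v v₁ v v₁)
    {rhsR rhsI : (ℝ → ℝ) → (ℝ → ℝ) → ℝ} {P Q : WithLp 2 (Esp L hL × Esp L hL)}
    (hP : ∀ v v₁ : ℝ → ℝ, IsCompactTest v v₁ →
      linForm L d V (prim (der P.fst)) (der P.fst) v v₁ - t * ∫ y, (L ^ 2 + y ^ 2) * (prim (der P.snd) y * v y) = rhsR v v₁ ∧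
        linForm L d V (prim (der P.snd)) (der P.snd) v v₁ + t * ∫ y, (L ^ 2 + y ^ 2) * (prim (der P.fst) y * v y) = rhsI v v₁)
    (hQ : ∀ v v₁ : ℝ → ℝ, IsCompactTest v v₁ →
      linForm L d V (prim (der Q.fst)) (der Q.fst) v v₁ - t * ∫ y, (L ^ 2 + y ^ 2) * (prim (der Q.snd) y * v y) = rhsR v v₁ ∧
        linForm L d V (prim (der Q.snd)) (der Q.snd) v v₁ + t * ∫ y, (L ^ 2 + y ^ 2) * (prim (der Q.fst) y * v y) = rhsI v v₁) :
    P = Q := by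
  obtain ⟨huR, hoR, hmR, h0R, h1R, -, -⟩ := energyClass_of_mem hL P.fst
  obtain ⟨huI, hoI, hmI, h0I, h1I, -, -⟩ := energyClass_of_mem hL P.snd
  obtain ⟨huR', hoR', hmR', h0R', h1R', -, -⟩ := energyClass_of_mem hL Q.fst
  obtain ⟨huI', hoI', hmI', h0I', h1I', -, -⟩ := energyClass_of_mem hL Q.snd
  obtain ⟨hdR, hodR, hmdR, h0dR, h1dR⟩ := energyClass_sub hL huR hoR hmR h0R h1R huR' hoR' hmR' h0R' h1R'
  obtain ⟨hdI, hodI, hmdI, h0dI, h1dI⟩ := energyClass_sub hL huI hoI hmI h0I h1I huI' hoI' hmI' h0I' h1I'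
  -- the differences solve the homogeneous pair system
  have hlinR : ∀ φ φ₁ : ℝ → ℝ, IsCompactTest φ φ₁ →
      linForm L d V (fun ξ => prim (der P.fst) ξ - prim (der Q.fst) ξ) (fun ξ => der P.fst ξ - der Q.fst ξ) φ φ₁ =
        t * ∫ y, (L ^ 2 + y ^ 2) * ((prim (der P.snd) y - prim (der Q.snd) y) * φ y) := by
    intro φ φ₁ hφ
    rw [linForm_sub_left (abs_linForm_profile_le hL hdm hVm hD₁ hd hV ⟨(φ, φ₁), hφ⟩ P.fst).1
      (abs_linForm_profile_le hL hdm hVm hD₁ hd hV ⟨(φ, φ₁), hφ⟩ Q.fst).1]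
    have e1 := (hP φ φ₁ hφ).1
    have e2 := (hQ φ φ₁ hφ).1
    have hi := integral_sub (integrable_profile_mul_test hL P.snd ⟨(φ, φ₁), hφ⟩).1
      (integrable_profile_mul_test hL Q.snd ⟨(φ, φ₁), hφ⟩).1
    have e3 : ∫ y, (L ^ 2 + y ^ 2) * ((prim (der P.snd) y - prim (der Q.snd) y) * φ y) =
        (∫ y, (L ^ 2 + y ^ 2) * (prim (der P.snd) y * φ y)) - ∫ y, (L ^ 2 + y ^ 2) * (prim (der Q.snd) y * φ y) := by
      rw [← hi]; exact integral_congr_ae (Eventually.of_forall fun y => by ring)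
    rw [e3]
    change linForm L d V (prim (der P.fst)) (der P.fst) φ φ₁ - linForm L d V (prim (der Q.fst)) (der Q.fst) φ φ₁ = _
    linarith
  have hlinI : ∀ φ φ₁ : ℝ → ℝ, IsCompactTest φ φ₁ →
      linForm L d V (fun ξ => prim (der P.snd) ξ - prim (der Q.snd) ξ) (fun ξ => der P.snd ξ - der Q.snd ξ) φ φ₁ =
        -t * ∫ y, (L ^ 2 + y ^ 2) * ((prim (der P.fst) y - prim (der Q.fst) y) * φ y) := by
    intro φ φ₁ hφ
    rw [linForm_sub_left (abs_linForm_profile_le hL hdm hVm hD₁ hd hV ⟨(φ, φ₁), hφ⟩ P.snd).1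
      (abs_linForm_profile_le hL hdm hVm hD₁ hd hV ⟨(φ, φ₁), hφ⟩ Q.snd).1]
    have e1 := (hP φ φ₁ hφ).2
    have e2 := (hQ φ φ₁ hφ).2
    have hi := integral_sub (integrable_profile_mul_test hL P.fst ⟨(φ, φ₁), hφ⟩).1
      (integrable_profile_mul_test hL Q.fst ⟨(φ, φ₁), hφ⟩).1
    have e3 : ∫ y, (L ^ 2 + y ^ 2) * ((prim (der P.fst) y - prim (der Q.fst) y) * φ y) =
        (∫ y, (L ^ 2 + y ^ 2) * (prim (der P.fst) y * φ y)) - ∫ y, (L ^ 2 + y ^ 2) * (prim (der Q.fst) y * φ y) := by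
      rw [← hi]; exact integral_congr_ae (Eventually.of_forall fun y => by ring)
    rw [e3]
    change linForm L d V (prim (der P.snd)) (der P.snd) φ φ₁ - linForm L d V (prim (der Q.snd)) (der Q.snd) φ φ₁ = _
    linarith
  obtain ⟨hzR, hzI⟩ := pair_eq_zero_of_weak hL hdm hVm hD₀ hD₁ hd hV hκ hcoer hdR hodR hmdR h0dR h1dR hdI hodI hmdI h0dI h1dI t
    hlinR hlinI
  have hfst : P.fst = Q.fst := ext_of_prim_eq hL fun x => by have := hzR x; linarith
  have hsnd : P.snd = Q.snd := ext_of_prim_eq hL fun x => by have := hzI x; linarith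
  exact WithLp.ofLp_injective 2 (Prod.ext hfst hsnd)

end Assembly

end SheetRResolventPair
end Summit.NavierStokesRegularity.OSWSelfSimilar

end
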